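import Summits.MatrixMultiplication.MatrixMultiplication.Theses.NOFWindowCapacity
import Literature.Computability.AlgebraicComplexity.GroupAlgebraTensor
import Literature.Computability.AlgebraicComplexity.GroupTheoreticMatMulProofs

/-!
# MatrixMultiplication / NOFWindowCapacity — `PartitionRankBound` (stmt-MatrixMultiplication-7275)

Route `NOFWindowCapacity`, support item `PartitionRankBound` — Alman–Blasiok's partition lemma
(Alman–Blasiok 2023, arXiv:2302.11476, §3.9 Thm. 32 with the subadditive measure `r = R`, and
§3.10): if `B` ALIEN-FREE boxes `P_r × Q_r × R_r` (`r < B`; output / `X` / `Y` index sets in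
`[N]²`) PARTITION the `N³` matrix-multiplication triples `((i,k), (i,j), (j,k))`, where the box
condition is read on the addition table of a finite abelian group `G` through Cohn–Umans legs
`s t u : [N] → G` (`X`-entry `(i,j) ↦ t j − s i`, `Y`-entry `(j,k) ↦ u k − t j`, output
`(i,k) ↦ u k − s i`), then `R(⟨N,N,N⟩) ≤ B · |G|` over `ℂ`.

## Proof (linear accounting, as in the route text)

For each box `r` let `T_r(a,b,c) = [a ∈ P_r][b ∈ Q_r][c ∈ R_r]·[leg b + leg c = leg a]` — the
addition table `[x + y = z]` of `G` pulled back along the legs (`tensorRank_precomp_le`, rank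
`≤ |G|` by the character decomposition `tensorRank_addGroupAlgTensor_le`) and ZEROED OUT to the box
(a diagonal scaling by `0/1` vectors, `nofPartition_tensorRank_scale_le`), so `R(T_r) ≤ |G|`
(`nofPartition_tensorRank_box_le`). Alien-freeness says `T_r` is supported on MM triples; on an
MM triple the leg equation holds identically (`(t j − s i) + (u k − t j) = u k − s i`), so
`T_r(a,b,c) = [the MM triple (a,b,c) lies in box r]`, and the partition hypothesis (`∃!`) gives
`∑_r T_r = ⟨N,N,N⟩` (`nofPartition_matMulTensor_eq_sum`). Subadditivity (`tensorRank_sum_le`)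
finishes: `R(⟨N,N,N⟩) ≤ ∑_r R(T_r) ≤ B·|G|`.

No new definitions: the box tensors are written as explicit coordinate functions.

## References

* J. Alman, J. Błasiok, *Matrix multiplication and number on the forehead communication*,
  CCC 2023, arXiv:2302.11476, §3.9 Thm. 32, §3.10 Fact 37 / Lemma 38. [AlmanBlasiok2023]
* M. Bläser, *Fast Matrix Multiplication*, ToC Graduate Surveys 5 (2013), §4 (subadditivity),
  Lemma 5.4 (restriction). [Blaser2013]
-/

-- the tree's namespace `Summit.MatrixMultiplication.MatrixMultiplication.…` repeats a component by design
set_option linter.dupNamespace false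

noncomputable section

open scoped BigOperators

namespace Summit.MatrixMultiplication.MatrixMultiplication.Theorems

open Literature.Computability.AlgebraicComplexity
open Summit.MatrixMultiplication.MatrixMultiplication.Theses.NOFWindowCapacity

universe u v₁ v₂ v₃

/-- **Zeroing-out / diagonal scaling does not increase the rank**: for coordinate vectors
`f, g, h` on the three index sets, `R((a,b,c) ↦ f a · g b · h c · x(a,b,c)) ≤ R(x)` — each triad
`w ⊗ u ⊗ v` of a decomposition of `x` becomes the triad `(f·w) ⊗ (g·u) ⊗ (h·v)` (Bläser 2013,
Lemma 5.4, for the diagonal maps `diag f, diag g, diag h`). -/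
theorem nofPartition_tensorRank_scale_le {K : Type u} [CommSemiring K] {ι : Type v₁} {κ : Type v₂}
    {μ : Type v₃} [Fintype ι] [Fintype κ] [Fintype μ] (x : ι → κ → μ → K) (f : ι → K) (g : κ → K)
    (h : μ → K) :
    tensorRank (fun a b c => f a * g b * h c * x a b c) ≤ tensorRank x := by
  obtain ⟨w, u, v, e⟩ := exists_triad_decomposition_tensorRank x
  refine tensorRank_le_of_eq_sum (fun i a => f a * w i a) (fun i b => g b * u i b)
    (fun i c => h c * v i c) ?_
  funext a b c
  rw [sum_triad_apply]
  conv_lhs => rw [e]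
  rw [sum_triad_apply, Finset.mul_sum]
  refine Finset.sum_congr rfl fun i _ => ?_
  ring

/-- **One alien-free box costs at most `|G|`**: the box tensor
`T(a,b,c) = [a ∈ P][b ∈ Q][c ∈ R]·[(t b₂ − s b₁) + (u c₂ − t c₁) = u a₂ − s a₁]` is the addition
table `[x + y = z]` of `G` (rank `≤ |G|`, characters) pulled back along the Cohn–Umans legs and
zeroed out to the box, so `R(T) ≤ |G|` (Alman–Blasiok 2023, §3.9–3.10: a rectangle of the table
of `G` is a zeroing-out of `T_G`, `R(T_G) = |G|` for abelian `G`). -/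
theorem nofPartition_tensorRank_box_le {N : ℕ} {G : Type} [AddCommGroup G] [Fintype G]
    [DecidableEq G] (s t u : Fin N → G) (P Q R : Finset (Fin N × Fin N)) :
    tensorRank (fun a b c : Fin N × Fin N =>
        if a ∈ P ∧ b ∈ Q ∧ c ∈ R ∧ (t b.2 - s b.1) + (u c.2 - t c.1) = u a.2 - s a.1
        then (1 : ℂ) else 0) ≤ Fintype.card G := by
  set D : G → G → G → ℂ := fun z x y => if x + y = z then 1 else 0 with hD
  have h3 : tensorRank D ≤ Fintype.card G := tensorRank_addGroupAlgTensor_le G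
  have h2 := tensorRank_precomp_le D (fun a : Fin N × Fin N => u a.2 - s a.1)
    (fun b : Fin N × Fin N => t b.2 - s b.1) (fun c : Fin N × Fin N => u c.2 - t c.1)
  have h1 := nofPartition_tensorRank_scale_le
    (fun a b c : Fin N × Fin N => D (u a.2 - s a.1) (t b.2 - s b.1) (u c.2 - t c.1))
    (fun a => if a ∈ P then (1 : ℂ) else 0) (fun b => if b ∈ Q then (1 : ℂ) else 0)
    (fun c => if c ∈ R then (1 : ℂ) else 0)
  have heq : (fun a b c : Fin N × Fin N =>
        if a ∈ P ∧ b ∈ Q ∧ c ∈ R ∧ (t b.2 - s b.1) + (u c.2 - t c.1) = u a.2 - s a.1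
        then (1 : ℂ) else 0) =
      fun a b c : Fin N × Fin N => (if a ∈ P then (1 : ℂ) else 0) * (if b ∈ Q then (1 : ℂ) else 0) *
        (if c ∈ R then (1 : ℂ) else 0) * D (u a.2 - s a.1) (t b.2 - s b.1) (u c.2 - t c.1) := by
    funext a b c
    simp only [hD]
    by_cases ha : a ∈ P <;> by_cases hb : b ∈ Q <;> by_cases hc : c ∈ R <;>
      by_cases hg : (t b.2 - s b.1) + (u c.2 - t c.1) = u a.2 - s a.1 <;> simp [ha, hb, hc, hg]
  rw [heq]
  exact h1.trans (h2.trans h3)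

/-- **The box tensors of an alien-free partition sum to `⟨N,N,N⟩`**: if every box is alien-free
(a table triple of the box is an MM triple) and every MM triple `((i,k),(i,j),(j,k))` lies in
exactly one box, then `∑_r T_r = ⟨N,N,N⟩` entrywise — on an MM triple the leg equation
`(t j − s i) + (u k − t j) = u k − s i` holds identically and exactly one box contributes `1`;
off the MM support every `T_r` vanishes by alien-freeness (Alman–Blasiok 2023, Thm. 32: a
protocol's monochromatic boxes partition the `1`-inputs). -/
theorem nofPartition_matMulTensor_eq_sum {N : ℕ} {G : Type} [AddCommGroup G] [DecidableEq G]
    (s t u : Fin N → G) {B : ℕ} (P Q R : Fin B → Finset (Fin N × Fin N))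
    (hAF : ∀ r : Fin B, ∀ a ∈ P r, ∀ b ∈ Q r, ∀ c ∈ R r,
      (t b.2 - s b.1) + (u c.2 - t c.1) = u a.2 - s a.1 → a.1 = b.1 ∧ b.2 = c.1 ∧ a.2 = c.2)
    (hPart : ∀ i j k : Fin N, ∃! r : Fin B, (i, k) ∈ P r ∧ (i, j) ∈ Q r ∧ (j, k) ∈ R r) :
    matMulTensor ℂ N N N = ∑ r : Fin B, fun a b c : Fin N × Fin N =>
      if a ∈ P r ∧ b ∈ Q r ∧ c ∈ R r ∧ (t b.2 - s b.1) + (u c.2 - t c.1) = u a.2 - s a.1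
      then (1 : ℂ) else 0 := by
  funext a b c
  obtain ⟨i, k⟩ := a
  obtain ⟨i', j⟩ := b
  obtain ⟨j', k'⟩ := c
  rw [Finset.sum_apply, Finset.sum_apply, Finset.sum_apply]
  simp only [matMulTensor]
  by_cases hmm : i = i' ∧ j = j' ∧ k = k'
  · obtain ⟨rfl, rfl, rfl⟩ := hmm
    rw [if_pos ⟨rfl, rfl, rfl⟩]
    obtain ⟨r₀, hr₀, huniq⟩ := hPart i j k
    have hg : (t j - s i) + (u k - t j) = u k - s i := by abel
    rw [Finset.sum_eq_single r₀]
    · rw [if_pos ⟨hr₀.1, hr₀.2.1, hr₀.2.2, hg⟩]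
    · intro r _ hr
      rw [if_neg]
      rintro ⟨h1, h2, h3, -⟩
      exact hr (huniq r ⟨h1, h2, h3⟩)
    · intro h
      exact absurd (Finset.mem_univ r₀) h
  · rw [if_neg hmm]
    refine (Finset.sum_eq_zero fun r _ => ?_).symm
    rw [if_neg]
    rintro ⟨h1, h2, h3, h4⟩
    exact hmm (hAF r _ h1 _ h2 _ h3 h4)

/-- **`PartitionRankBound`** (route NOFWindowCapacity, stmt-MatrixMultiplication-7275) —
Alman–Blasiok's partition lemma (arXiv:2302.11476, §3.9 Thm. 32 with `r = R`, §3.10): if `B`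
alien-free boxes partition the MM triples of `⟨N,N,N⟩` read on the table of a finite abelian group
`G` through legs `s, t, u`, then `R(⟨N,N,N⟩) ≤ B · |G|` over `ℂ` — each box tensor has rank
`≤ |G|` (`nofPartition_tensorRank_box_le`), the box tensors sum to `⟨N,N,N⟩`
(`nofPartition_matMulTensor_eq_sum`), and rank is subadditive (`tensorRank_sum_le`). -/
theorem partitionRankBound_proof :
    Summit.MatrixMultiplication.MatrixMultiplication.Theses.NOFWindowCapacity.PartitionRankBound := by
  unfold PartitionRankBound
  intro N G _ _ s t u B P Q R hAF hPart
  classical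
  rw [nofPartition_matMulTensor_eq_sum s t u P Q R hAF hPart]
  calc tensorRank (∑ r : Fin B, fun a b c : Fin N × Fin N =>
          if a ∈ P r ∧ b ∈ Q r ∧ c ∈ R r ∧ (t b.2 - s b.1) + (u c.2 - t c.1) = u a.2 - s a.1
          then (1 : ℂ) else 0)
        ≤ ∑ r : Fin B, tensorRank (fun a b c : Fin N × Fin N =>
          if a ∈ P r ∧ b ∈ Q r ∧ c ∈ R r ∧ (t b.2 - s b.1) + (u c.2 - t c.1) = u a.2 - s a.1
          then (1 : ℂ) else 0) := tensorRank_sum_le _ _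
    _ ≤ ∑ _r : Fin B, Fintype.card G :=
        Finset.sum_le_sum fun r _ => nofPartition_tensorRank_box_le s t u (P r) (Q r) (R r)
    _ = B * Fintype.card G := by simp

end Summit.MatrixMultiplication.MatrixMultiplication.Theorems

end
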